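import Literature.NumberTheory.GaloisRepresentations.IdeleClassBarRelativeInvariant
import Literature.NumberTheory.GaloisRepresentations.IdeleClassBarInvariant
import Literature.Algebra.Homology.DiscreteRepLayerRestriction
import Literature.Algebra.Homology.DiscreteRepInvariantCores
import Literature.Algebra.Homology.DiscreteRepTateDuality
import HarnessLib

/-!
# The invariant map at an open subgroup, `inv_U : H²(U, C̄) ⥲ ℚ/ℤ`, the axiom `inv_U ∘ Res = [Γ_F : U] · inv_F`, and
# the field `invAt_bijective` of Tate's duality theorem for the idèle class formation `(Γ_F, C̄)`
# (Serre, *Local Fields* XI §2–§3; Tate, C–F VII §11.2 (bis); Milne ADT I §1, Thm. 1.8)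

Topic `NumberTheory/GaloisRepresentations`; namespace `Literature.NumberTheory.GaloisRepresentations.IdeleClassBar`.
Sequel to door-c4 g16's `IdeleClassBarRelativeInvariant.lean` (the compatible family `relLayerInv` of invariants of
the relative layers `H²(H_E, C_E)` over the trace layers of an open subgroup `U ≤ Γ_F`), `IdeleClassBarInvariant.lean`
(`classBarInv F = inv_F` on `Ext²_{C_Γ}(ℤ, classBarD F)`), `DiscreteRepLayerColimitDesc.lean`
(`LayerColimit.desc`), `DiscreteRepLayerRestriction.lean` (`extRes_inflG`: restriction read on the layers) and door-c4
g15's `DiscreteRepInvariantCores.lean` (`bijective_inv_comp_extCores`), `DiscreteRepTateDuality.lean` (`invAt`,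
`TateDualityHypotheses`); door-c6 g15's relative layers (`GalLayerSystemSubgroupLayers.lean`) and door-c5 g16's
`classData` / `layerCohomologyIso`.  Definitions with bodies (`classBarInvAt`) and theorems; NO named fact, no `sorry`, no
instance, no notation; number fields in `Type`; `Γ_F = Field.absoluteGaloisGroup F`, profinite via the `Prop`-mixins
`[CompactSpace Γ_F] [TotallyDisconnectedSpace Γ_F]`.

THE POINT.  For an open subgroup `U = Gal(F̄/L) ≤ Γ_F` the invariant map of the idèle class formation at `U`,
**`inv_U : H²(U, C̄) = Ext²_{C_U}(ℤ, Res_U C̄) → ℚ/ℤ`** (`classBarInvAt`), is the descent to door-c4's colimit (d) for the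
group `U` of the invariants `inv_{H_E} : H²(H_E, C_E) ⥲ (1/|H_E|)ℤ/ℤ` of the relative layers; it is BIJECTIVE
(`classBarInvAt_bijective`: injective on each layer, and every `a/N` is an invariant at a layer `E ⊇ L` with `N ∣ [E:L]`),
and satisfies the class-formation axiom **`inv_U (Res x) = [Γ_F : U] · inv_F (x)`** (`classBarInvAt_extRes`): on a
class inflated from `H²(Gal(E/F), C_E)` the restriction `Res : H²(Γ_F, C̄) → H²(U, C̄)` is the finite-level restriction
to `H_E` (door-c4 `extRes_inflG` + `relLayerCohomologyIso_map_traceQuotMap` below), where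
`inv_{H_E} ∘ res = [Gal(E/F) : H_E] · inv_E` (class modules) and `[Gal(E/F) : H_E] = [Γ_F : U]`.  CONSEQUENTLY
(door-c4 `bijective_inv_comp_extCores`: `cores ∘ res = [Γ:U]`, `res` onto) **the field `invAt_bijective` of
`TateDualityHypotheses (classBarD F) (classBarInvD F)` holds at every open normal subgroup `U ≤ Γ_F`**
(`invAt_classBarD_bijective`): `inv_F ∘ cores_U : Ext²_{C_U}(ℤ, Res_U C̄) → ℚ/ℤ` is bijective.

## What is formalised (`F : Type` a number field, `Γ = absoluteGaloisGroup F`, `U : Subgroup Γ` open / `OpenNormalSubgroup Γ`)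

* §17 **`classBarInvAt F U hU : Ext²_{C_U}(ℤ, Res_U C̄) →+ ℚ/ℤ`**, `classBarInvAt_inflG` (`= inv_{H_E} ∘ relLayerCohomologyIso`
  on the trace layers), `classBarInvAt_injective`, `classBarInvAt_surjective`, **`classBarInvAt_bijective`**.
* §18 **`GalLayerData.map_traceQuotMap_comp_relLayerCohomologyIso`** (generic `D`: door-c4's layer restriction map
  `Hⁿ(traceQuotMap, traceLayerHom)` is the finite-level restriction `res_{H_E}` under door-c5/door-c6's isomorphisms),
  **`classBarInvAt_extRes : inv_U (Res x) = [Γ:U] • inv_F x`**.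
* §16' `layerInvD`, `classBarInvD F` (= `inv_F` on `Ext²_{C_Γ}(ℤ, C̄)` in the currency `C̄ = (classData F).toSystem.toD`, bijective;
  the same map as door-c4 g16's `classBarInv F` on the definitionally equal `classBarD F`, rebuilt with door-c5's generic dictionary).
* §19 **`invAt_classData_bijective` / `invAt_classBarD_bijective : ∀ U : OpenNormalSubgroup Γ_F, Bijective (invAt (classBarD F) (classBarInvD F) U)`**.

HONEST FRAMING: classical class field theory bookkeeping (Tate 1967) in the tree's normalisation; no case of BSD or of
Poitou–Tate is proved.  With door-c6 g15's `ext_one_eq_zero` / `ext_triv_eq_zero_of_three_le` and door-c4 g15's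
`ext_one_triv_eq_zero` this is the fourth of the six fields of `TateDualityHypotheses (classBarD F) (classBarInvD F)`;
`adjointBijective_one_zmod` and Lemma 1.9 (`hN`) remain.  Route A (A5)-ARITH of crux `AnticycControlAdditiveK`
(item 19295, cell bsd-schneider), seat door-c4 gen 16.

## References
* J.-P. Serre, *Local Fields*, GTM 67 (1979), XI §2 Proposition 1, §3. [Serre1979]
* J. W. S. Cassels, A. Fröhlich (eds.), *Algebraic Number Theory* (1967), Ch. VII (J. Tate) §11.2 (bis). [CasselsFrohlichANT1967]
* J. S. Milne, *Arithmetic Duality Theorems* (2nd ed. 2006), I §1 (class formations (1.1)), Theorem 1.8. [MilneADT2006]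
* J.-P. Serre, *Galois Cohomology* (1997), I §2.2 Proposition 8. [SerreGaloisCohomology1997]
-/

noncomputable section

open NumberField CategoryTheory groupCohomology
open Field (absoluteGaloisGroup)
open Literature.NumberTheory.Automorphic Literature.NumberTheory.Automorphic.IdeleClassGroup
open Literature.NumberTheory.NumberFields
open Literature.Algebra.Homology Literature.Algebra.Homology.DiscreteRep
open Literature.AnabelianGeometry.AbsoluteAnabelian.Prop121vii (zmodToQmodZ)
open scoped Classical

namespace Literature.NumberTheory.GaloisRepresentations

open IdeleClassBar

/-! ## §18a. Door-c4's layer restriction map is the finite-level restriction (generic layer system) -/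

namespace GalLayerData

variable {F : Type} [Field F] [NumberField F] (D : GalLayerData F) (U : Subgroup (absoluteGaloisGroup F))

set_option maxHeartbeats 1600000 in
-- two `groupCohomology.map` composites compared through Mathlib's `map_comp` / the cell's `map_congr'`; the
-- `ℤ`-instance paths of the relative layer objects make the unification slow (cf. `stepG_comp_relLayerCohomologyIso`)
/-- **`Hⁿ(traceQuotMap, traceLayerHom) ≫ relIso_E = absIso_E ≫ res_{H_E}`** (`U_E ≤ U`): door-c4's restriction map
between the layers of `Γ_F` and of `U` (`DiscreteRepLayerRestriction`) is, under door-c5's `layerCohomologyIso` and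
door-c6's `relLayerCohomologyIso`, the restriction `Hⁿ(Gal(E/F), D.obj E) → Hⁿ(H_E, Res D.obj E)` of the finite layer
(both composites are `groupCohomology.map` along `H_E → Γ_F ⧸ U_E`, `u|_E ↦ [u]`, with underlying map `layerEquiv`).
[cite: SerreGaloisCohomology1997, I §2.2 Proposition 8][cite: Serre1979, XI §2 Proposition 1] -/
theorem map_traceQuotMap_comp_relLayerCohomologyIso {E : GalLayer F}
    (hE : (E.openNormalSubgroup : Subgroup (absoluteGaloisGroup F)) ≤ U) (n : ℕ) :
    groupCohomology.map (traceQuotMap U E.openNormalSubgroup) (traceLayerHom U E.openNormalSubgroup D.toSystem.toD) n ≫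
        (D.relLayerCohomologyIso (U := U) hE n).hom =
      (D.layerCohomologyIso E n).hom ≫ groupCohomology.map (GalLayer.subgroupImage U E).subtype
        (𝟙 (Rep.res (GalLayer.subgroupImage U E).subtype (D.obj E))) n := by
  rw [relLayerCohomologyIso, layerCohomologyIso, groupCohomology.mapIso_hom, groupCohomology.mapIso_hom,
    ← groupCohomology.map_comp, ← groupCohomology.map_comp]
  refine map_congr' ?_ _ _ (fun z => ?_) n
  · refine MonoidHom.ext fun τ => ?_
    obtain ⟨u, rfl⟩ := GalLayer.toSubgroupImage_surjective U E τ
    change traceQuotMap U E.openNormalSubgroup ((GalLayer.subgroupImageEquiv U E).symm (GalLayer.toSubgroupImage U E u)) =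
      E.quotEquiv.symm ((GalLayer.toSubgroupImage U E u : GalLayer.subgroupImage U E) : E.1 ≃ₐ[F] E.1)
    rw [← GalLayer.subgroupImageEquiv_mk, MulEquiv.symm_apply_apply, traceQuotMap_mk,
      GalLayer.coe_subgroupImageEquiv_mk, GalLayer.quotEquiv_symm_restrictHom]
  · rfl

/-- Elementwise form: `relIso_E (Hⁿ(traceQuotMap, traceLayerHom) c) = res_{H_E} (absIso_E c)`.
[cite: SerreGaloisCohomology1997, I §2.2 Proposition 8] -/
theorem relLayerCohomologyIso_map_traceQuotMap {E : GalLayer F}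
    (hE : (E.openNormalSubgroup : Subgroup (absoluteGaloisGroup F)) ≤ U) (n : ℕ) (c : groupCohomology (D.layerRep E) n) :
    (D.relLayerCohomologyIso (U := U) hE n).hom
        (groupCohomology.map (traceQuotMap U E.openNormalSubgroup)
          (traceLayerHom U E.openNormalSubgroup D.toSystem.toD) n c) =
      groupCohomology.map (GalLayer.subgroupImage U E).subtype
        (𝟙 (Rep.res (GalLayer.subgroupImage U E).subtype (D.obj E))) n ((D.layerCohomologyIso E n).hom c) := by
  rw [← ModuleCat.comp_apply, D.map_traceQuotMap_comp_relLayerCohomologyIso U hE n, ModuleCat.comp_apply]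

end GalLayerData

namespace IdeleClassBar

variable (F : Type) [Field F] [NumberField F]

/-! ## §16'. `inv_F` in the currency of the layer system `classData F` (`C̄ = (classData F).toSystem.toD`)

Door-c4 g16's `classBarInv F` (`IdeleClassBarInvariant.lean`) is the same map on the definitionally equal object
`classBarD F`; it is rebuilt here on `(classData F).toSystem.toD` with door-c5's generic dictionary
(`GalLayerData.layerCohomologyIso`, `classData_inf`) and the class-module invariant `IsClassModule.inv` of the layer,
because the relative layers of door-c6 live in this currency and the unifier cannot afford to identify the layer
objects `C̄^{U_E}` of the two spellings inside `groupCohomology`. -/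

/-- The invariant map of the layer `C̄^{U_E}` in `classData` currency: the class-module invariant `inv_E` of
`(Gal(E/F), C_E)` (`= inv_{E/F}`, `inv_layerCocycle_apply`) after `(classData F).layerCohomologyIso E 2`.
[cite: CasselsFrohlichANT1967, Ch. VII §11.2 (bis)][cite: Serre1979, XI §3] -/
def layerInvD (E : GalLayer F) : groupCohomology ((classData F).layerRep E) 2 →+ AddCircle (1 : ℚ) :=
  (haveI := finite_gal F E; (isClassModule_layerCocycle F E).inv).comp
    ((classData F).layerCohomologyIso E 2).hom.hom.toAddMonoidHom

set_option maxHeartbeats 1000000 in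
-- coercion bookkeeping `⇑(L.toAddMonoidHom) = ⇑L` against the `ℤ`-instance paths of `H²(Gal(E/F), C_E)` is slow
/-- Formula: `layerInvD E c = inv_E (absIso_E c)`. [cite: Serre1979, XI §3] -/
theorem layerInvD_apply (E : GalLayer F) (c : groupCohomology ((classData F).layerRep E) 2) :
    layerInvD F E c = (haveI := finite_gal F E;
      (isClassModule_layerCocycle F E).inv (((classData F).layerCohomologyIso E 2).hom c)) := by
  rw [layerInvD, AddMonoidHom.coe_comp, Function.comp_apply, LinearMap.toAddMonoidHom_coe]

/-- `layerInvD E (absIso_E⁻¹ y) = inv_{E/F} y`. [cite: CasselsFrohlichANT1967, Ch. VII §11.2 (bis)] -/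
theorem layerInvD_iso_inv (E : GalLayer F) (y : groupCohomology ((classData F).obj E) 2) :
    layerInvD F E (((classData F).layerCohomologyIso E 2).inv y) =
      (haveI := E.numberField; haveI := E.isGalois; IdeleCohomology.classInvAll F E.1 y) := by
  rw [layerInvD_apply, ← ModuleCat.comp_apply, Iso.inv_hom_id, ModuleCat.id_apply]
  exact inv_layerCocycle_apply F E y

/-- `layerInvD E` is injective. [cite: CasselsFrohlichANT1967, Ch. VII §11.2 (bis), Result] -/
theorem layerInvD_injective (E : GalLayer F) : Function.Injective (layerInvD F E) := by
  haveI := finite_gal F E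
  intro c c' h
  rw [layerInvD_apply, layerInvD_apply] at h
  have h' := (isClassModule_layerCocycle F E).inv_injective h
  have := congrArg ((classData F).layerCohomologyIso E 2).inv h'
  rwa [← ModuleCat.comp_apply, ← ModuleCat.comp_apply, Iso.hom_inv_id, ModuleCat.id_apply,
    ModuleCat.id_apply] at this

/-- `inv_{E'} (Inf y) = inv_E (y)` for the inflation of the system `classData F` (`= classInf`; `inv ∘ Inf = inv`).
[cite: CasselsFrohlichANT1967, Ch. VII §11.2 (diagram (4))] -/
theorem inv_classData_inf {E E' : GalLayer F} (h : E ≤ E') (y : groupCohomology ((classData F).obj E) 2) :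
    (haveI := finite_gal F E'; (isClassModule_layerCocycle F E').inv ((classData F).inf h 2 y)) =
      (haveI := finite_gal F E; (isClassModule_layerCocycle F E).inv y) := by
  haveI := E.numberField
  haveI := E'.numberField
  haveI := E.isGalois
  haveI := E'.isGalois
  letI := GalLayer.algebraOfLE h
  haveI := GalLayer.isScalarTower_of_le h
  rw [inv_layerCocycle_apply, inv_layerCocycle_apply, classData_inf h 2]
  exact IdeleCohomology.classInvAll_classInf F E.1 E'.1 y

/-- Compatibility with door-c4's transitions: `layerInvD E' (Hⁿ(quotMap, incl) c) = layerInvD E c` for `E ≤ E'`.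
[cite: CasselsFrohlichANT1967, Ch. VII §11.2 (bis)][cite: SerreGaloisCohomology1997, I §2.2 Proposition 8] -/
theorem layerInvD_stepG {E E' : GalLayer F} (h : E ≤ E') (c : groupCohomology ((classData F).layerRep E) 2) :
    layerInvD F E' (LayerColimit.stepG E.openNormalSubgroup E'.openNormalSubgroup
        (GalLayer.coe_openNormalSubgroup_le h) (classData F).toSystem.toD 2 c) = layerInvD F E c := by
  have key : ((classData F).layerCohomologyIso E' 2).hom (LayerColimit.stepG E.openNormalSubgroup
      E'.openNormalSubgroup (GalLayer.coe_openNormalSubgroup_le h) (classData F).toSystem.toD 2 c) =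
      (classData F).inf h 2 (((classData F).layerCohomologyIso E 2).hom c) := by
    rw [← ModuleCat.comp_apply, (classData F).map_invariantsStepIncl_comp_layerCohomologyIso h 2,
      ModuleCat.comp_apply]
  rw [layerInvD_apply, layerInvD_apply, key]
  exact inv_classData_inf F h _

/-- The layer invariants (in `classData` currency) form a compatible family over `E ↦ U_E`.
[cite: CasselsFrohlichANT1967, Ch. VII §11.2 (bis)][cite: SerreGaloisCohomology1997, I §2.2 Proposition 8] -/
theorem isCompatibleFamily_layerInvD :
    LayerColimit.IsCompatibleFamily (fun E : GalLayer F => E.openNormalSubgroup) (classData F).toSystem.toD 2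
      (fun E => layerInvD F E) := by
  refine ⟨fun W => ⟨GalLayer.ofOpenNormalSubgroup W, ?_⟩, fun E E' h c => ?_⟩
  · rw [GalLayer.openNormalSubgroup_ofOpenNormalSubgroup]
  · have h' : E ≤ E' := GalLayer.openNormalSubgroup_le_iff.1 fun x hx => h hx
    exact layerInvD_stepG F h' c

section LimitD

variable [CompactSpace (absoluteGaloisGroup F)] [TotallyDisconnectedSpace (absoluteGaloisGroup F)]

/-- **`inv_F : Ext²_{C_Γ}(ℤ, C̄) →+ ℚ/ℤ` in `classData` currency** (`C̄ = (classData F).toSystem.toD`): the descent of the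
layer invariants `layerInvD`. [cite: CasselsFrohlichANT1967, Ch. VII §11.2 (bis)][cite: MilneADT2006, I §1] -/
def classBarInvD :
    Abelian.Ext (triv (k := ℤ) (Γ := absoluteGaloisGroup F) ℤ) (classData F).toSystem.toD 2 →+ AddCircle (1 : ℚ) :=
  LayerColimit.desc (fun E : GalLayer F => E.openNormalSubgroup) (classData F).toSystem.toD 2 (fun E => layerInvD F E)
    (isCompatibleFamily_layerInvD F)

/-- **`inv_F (Inf_E c) = inv_E (absIso_E c)`** (`classData` currency).
[cite: CasselsFrohlichANT1967, Ch. VII §11.2 (bis)] -/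
theorem classBarInvD_inflG (E : GalLayer F) (c : groupCohomology ((classData F).layerRep E) 2) :
    classBarInvD F (LayerColimit.inflG E.openNormalSubgroup (classData F).toSystem.toD 2 c) =
      (haveI := finite_gal F E; (isClassModule_layerCocycle F E).inv (((classData F).layerCohomologyIso E 2).hom c)) :=
  (LayerColimit.desc_inflG (isCompatibleFamily_layerInvD F) E c).trans (layerInvD_apply F E c)

/-- `inv_F` is injective (`classData` currency). [cite: CasselsFrohlichANT1967, Ch. VII §11.2 (bis), Result] -/
theorem classBarInvD_injective : Function.Injective (classBarInvD F) :=
  LayerColimit.desc_injective (isCompatibleFamily_layerInvD F) fun E => layerInvD_injective F E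

/-- `inv_F` is surjective (`classData` currency). [cite: CasselsFrohlichANT1967, Ch. VII §11.2 (bis)] -/
theorem classBarInvD_surjective : Function.Surjective (classBarInvD F) := by
  refine LayerColimit.desc_surjective (isCompatibleFamily_layerInvD F) fun t => ?_
  obtain ⟨M, hfin, hgal, hnf, y, hy⟩ := IdeleCohomology.exists_layer_classInvAll_eq F F t
  let E : GalLayer F := ⟨M, hfin, hgal⟩
  refine ⟨E, ((classData F).layerCohomologyIso E 2).inv y, ?_⟩
  rw [layerInvD_iso_inv]
  exact hy

/-- **`inv_F : H²(Γ_F, C̄) → ℚ/ℤ` is bijective** (`classData` currency).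
[cite: CasselsFrohlichANT1967, Ch. VII §11.2 (bis)][cite: MilneADT2006, I §1] -/
theorem classBarInvD_bijective : Function.Bijective (classBarInvD F) :=
  ⟨classBarInvD_injective F, classBarInvD_surjective F⟩

end LimitD

/-! ## §17. The invariant map at an open subgroup -/

section Subgroup

variable [CompactSpace (absoluteGaloisGroup F)] [TotallyDisconnectedSpace (absoluteGaloisGroup F)]
  (U : Subgroup (absoluteGaloisGroup F)) (hU : IsOpen (U : Set (absoluteGaloisGroup F)))

/-- **THE invariant map of the idèle class formation at an open subgroup, `inv_U : Ext²_{C_U}(ℤ, Res_U C̄) →+ ℚ/ℤ`** — the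
descent to door-c4's colimit for the group `U` of the invariants of the relative layers (`relLayerInv`).
[cite: Serre1979, XI §3][cite: CasselsFrohlichANT1967, Ch. VII §11.2 (bis)][cite: MilneADT2006, I §1] -/
def classBarInvAt :
    Abelian.Ext (triv (k := ℤ) (Γ := U) ℤ) ((resD ℤ U).obj (classData F).toSystem.toD) 2 →+ AddCircle (1 : ℚ) :=
  haveI : CompactSpace U := LayerColimit.compactSpace_subgroup_of_isOpen U hU
  LayerColimit.desc (subLayerTrace U) ((resD ℤ U).obj (classData F).toSystem.toD) 2 (fun E => relLayerInv U E.2)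
    (isCompatibleFamily_relLayerInv U hU)

/-- **`inv_U (Inf c) = relLayerInv_E c`** on a class inflated from the trace layer `U_E ∩ U` (`U_E ≤ U`).
[cite: Serre1979, XI §3][cite: SerreGaloisCohomology1997, I §2.2 Proposition 8] -/
theorem classBarInvAt_inflG {E : GalLayer F} (hE : (E.openNormalSubgroup : Subgroup (absoluteGaloisGroup F)) ≤ U)
    (c : groupCohomology ((classData F).relLayerRep U E) 2) :
    classBarInvAt F U hU (LayerColimit.inflG (traceOpenNormalSubgroup U E.openNormalSubgroup)
        ((resD ℤ U).obj (classData F).toSystem.toD) 2 c) = relLayerInv U hE c :=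
  haveI : CompactSpace U := LayerColimit.compactSpace_subgroup_of_isOpen U hU
  LayerColimit.desc_inflG (isCompatibleFamily_relLayerInv U hU) ⟨E, hE⟩ c

/-- **`inv_U` is injective** (each `relLayerInv_E` is). [cite: Serre1979, XI §2 Proposition 1] -/
theorem classBarInvAt_injective : Function.Injective (classBarInvAt F U hU) :=
  haveI : CompactSpace U := LayerColimit.compactSpace_subgroup_of_isOpen U hU
  LayerColimit.desc_injective (isCompatibleFamily_relLayerInv U hU) fun E => relLayerInv_injective U E.2

/-- Every element of `ℚ/ℤ` killed by `N ≥ 1` is an integer multiple of `1/N`. [folklore] -/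
private theorem exists_zsmul_oneDiv_eq {N : ℕ} (hN : 0 < N) (t : AddCircle (1 : ℚ)) (ht : N • t = 0) :
    ∃ r : ℤ, r • oneDiv N = t := by
  induction t using QuotientAddGroup.induction_on with
  | H q =>
    have hN' : (N : ℚ) ≠ 0 := Nat.cast_ne_zero.2 hN.ne'
    have h : ((N • q : ℚ) : AddCircle (1 : ℚ)) = 0 := by rw [AddCircle.coe_nsmul]; exact ht
    obtain ⟨m, hm⟩ := (AddCircle.coe_eq_zero_iff (1 : ℚ)).1 h
    rw [zsmul_eq_mul, mul_one, nsmul_eq_mul] at hm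
    refine ⟨m, ?_⟩
    rw [zsmul_oneDiv]
    congr 1
    rw [hm, mul_div_cancel_left₀ _ hN']

/-- Every `t ∈ ℚ/ℤ` is killed by some `N ≥ 1`. [folklore] -/
private theorem exists_nsmul_eq_zero' (t : AddCircle (1 : ℚ)) : ∃ N : ℕ, 0 < N ∧ N • t = 0 := by
  induction t using QuotientAddGroup.induction_on with
  | H q =>
    refine ⟨q.den, q.den_pos, ?_⟩
    change q.den • ((q : ℚ) : AddCircle (1 : ℚ)) = 0
    rw [← AddCircle.coe_nsmul, nsmul_eq_mul, Rat.den_mul_eq_num, ← zsmul_one, AddCircle.coe_zsmul,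
      AddCircle.coe_period, smul_zero]

/-- **`inv_U` is surjective** for `U` open NORMAL: every `a/N ∈ ℚ/ℤ` is the invariant of a class of the relative layer
at a layer `E ⊇ F̄^U` with `N ∣ |H_E|` (a layer of degree divisible by `N · [Γ:U]` composed with `F̄^U`).
[cite: CasselsFrohlichANT1967, Ch. VII §11.2 (bis)][cite: Serre1979, XI §3] -/
theorem classBarInvAt_surjective (U : OpenNormalSubgroup (absoluteGaloisGroup F)) :
    Function.Surjective (classBarInvAt F (U : Subgroup (absoluteGaloisGroup F)) U.toOpenSubgroup.isOpen) := by
  haveI : CompactSpace (U : Subgroup (absoluteGaloisGroup F)) :=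
    LayerColimit.compactSpace_subgroup_of_isOpen _ U.toOpenSubgroup.isOpen
  refine LayerColimit.desc_surjective (isCompatibleFamily_relLayerInv _ U.toOpenSubgroup.isOpen) fun t => ?_
  -- the layer `L = F̄^U` and the index `[Γ:U] = [L:F]`
  set L : GalLayer F := GalLayer.ofOpenNormalSubgroup U with hL
  have hLU : (L.openNormalSubgroup : Subgroup (absoluteGaloisGroup F)) ≤ U := by
    rw [GalLayer.openNormalSubgroup_ofOpenNormalSubgroup]
  have hidx : (U : Subgroup (absoluteGaloisGroup F)).index ≠ 0 := index_ne_zero_of_le _ L hLU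
  -- `t = r • (1/N)`
  obtain ⟨N, hN, hNt⟩ := exists_nsmul_eq_zero' t
  obtain ⟨r, rfl⟩ := exists_zsmul_oneDiv_eq hN t hNt
  -- a layer `E ⊇ L` with `N ∣ |H_E|`
  obtain ⟨M, hfin, hgal, hdvd⟩ := IdeleCohomology.exists_galoisLayer_finrank_dvd F F
    (N := N * (U : Subgroup (absoluteGaloisGroup F)).index) (mul_ne_zero hN.ne' hidx)
  let E₀ : GalLayer F := ⟨M, hfin, hgal⟩
  obtain ⟨E, hE₀E, hLE⟩ := GalLayer.exists_ge_ge E₀ L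
  have hEU : (E.openNormalSubgroup : Subgroup (absoluteGaloisGroup F)) ≤ U :=
    (GalLayer.coe_openNormalSubgroup_le hLE).trans hLU
  have hdvd' : N ∣ Nat.card (GalLayer.subgroupImage (U : Subgroup (absoluteGaloisGroup F)) E) := by
    have h1 : N * (U : Subgroup (absoluteGaloisGroup F)).index ∣
        Nat.card (GalLayer.subgroupImage (U : Subgroup (absoluteGaloisGroup F)) E) *
          (U : Subgroup (absoluteGaloisGroup F)).index := by
      rw [card_subgroupImage_mul_index _ E hEU]
      exact hdvd.trans (finrank_dvd_of_le hE₀E)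
    exact Nat.dvd_of_mul_dvd_mul_right (Nat.pos_of_ne_zero hidx) h1
  obtain ⟨k, hk⟩ := hdvd'
  have hk0 : 0 < k := Nat.pos_of_ne_zero fun h => card_subgroupImage_ne_zero _ E (by rw [hk, h, mul_zero])
  obtain ⟨c, hc⟩ := exists_relLayerInv_eq (U : Subgroup (absoluteGaloisGroup F)) hEU (r * k)
  refine ⟨⟨E, hEU⟩, c, ?_⟩
  change relLayerInv _ hEU c = r • oneDiv N
  rw [hc, hk, mul_comm N k, mul_zsmul, natCast_zsmul, nsmul_oneDiv_mul hk0]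

/-- **`inv_U : H²(U, C̄) → ℚ/ℤ` is bijective** for every open normal subgroup `U ≤ Γ_F`.
[cite: CasselsFrohlichANT1967, Ch. VII §11.2 (bis)][cite: MilneADT2006, I §1] -/
theorem classBarInvAt_bijective (U : OpenNormalSubgroup (absoluteGaloisGroup F)) :
    Function.Bijective (classBarInvAt F (U : Subgroup (absoluteGaloisGroup F)) U.toOpenSubgroup.isOpen) :=
  ⟨classBarInvAt_injective F _ _, classBarInvAt_surjective F U⟩

/-! ## §18. The axiom `inv_U ∘ Res = [Γ_F : U] · inv_F` -/

set_option maxHeartbeats 1000000 in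
-- the `ℤ`-module instance paths of `H²(H_E, Res C_E)` make the final rewriting slow (cf. `IdeleClassBarRelativeInvariant`)
/-- **`inv_U (Res x) = [Γ_F : U] · inv_F (x)`** for every `x ∈ Ext²_{C_Γ}(ℤ, C̄)` and `U` open normal: write
`x = Inf_E c` with `U_E ≤ U`; then `Res x = Inf_{U_E ∩ U} (H²(traceQuotMap, traceLayerHom) c)` (door-c4 `extRes_inflG`), whose
invariant is `inv_{H_E} (res_{H_E} (absIso c)) = [Gal(E/F) : H_E] · inv_E (absIso c)` (class modules), and
`[Gal(E/F) : H_E] = [Γ_F : U]`, `inv_E (absIso c) = inv_F (Inf_E c)`.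
[cite: Serre1979, XI §2 Proposition 1][cite: MilneADT2006, I §1 (1.1)] -/
theorem classBarInvAt_extRes (U : OpenNormalSubgroup (absoluteGaloisGroup F))
    (x : Abelian.Ext (triv (k := ℤ) (Γ := absoluteGaloisGroup F) ℤ) (classData F).toSystem.toD 2) :
    classBarInvAt F (U : Subgroup (absoluteGaloisGroup F)) U.toOpenSubgroup.isOpen
        (extRes (U : Subgroup (absoluteGaloisGroup F)) (triv (k := ℤ) (Γ := absoluteGaloisGroup F) ℤ)
          (classData F).toSystem.toD 2 x) =
      (U : Subgroup (absoluteGaloisGroup F)).index • classBarInvD F x := by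
  -- `x = Inf_E c` with `U_E ≤ U ∩ W`
  obtain ⟨W, c₀, rfl⟩ := LayerColimit.exists_inflG_eq 2 (classData F).toSystem.toD x
  set E : GalLayer F := GalLayer.ofOpenNormalSubgroup (W ⊓ U) with hEdef
  have hEWU : E.openNormalSubgroup = W ⊓ U := GalLayer.openNormalSubgroup_ofOpenNormalSubgroup _
  have hEW : (E.openNormalSubgroup : Subgroup (absoluteGaloisGroup F)) ≤ W := by
    rw [hEWU]; exact LayerColimit.coe_le_coe_of_le inf_le_left
  have hEU : (E.openNormalSubgroup : Subgroup (absoluteGaloisGroup F)) ≤ U := by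
    rw [hEWU]; exact LayerColimit.coe_le_coe_of_le inf_le_right
  rw [← LayerColimit.inflG_stepG W E.openNormalSubgroup hEW _ 2 c₀]
  set c := LayerColimit.stepG W E.openNormalSubgroup hEW (classData F).toSystem.toD 2 c₀
  haveI := finite_gal F E
  rw [LayerColimit.extRes_inflG, classBarInvAt_inflG F _ _ hEU, relLayerInv_apply,
    (classData F).relLayerCohomologyIso_map_traceQuotMap _ hEU 2 c,
    (isClassModule_layerCocycle F E).invSub_map_subtype, index_subgroupImage _ E hEU, classBarInvD_inflG]

/-! ## §19. The field `invAt_bijective` of Tate's duality theorem for `(Γ_F, C̄, inv_F)` -/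

/-- `ℚ/ℤ` is divisible: `q = m • q'` for every `m ≥ 1`. [folklore] -/
private theorem exists_eq_nsmul (m : ℕ) (hm : m ≠ 0) (q : AddCircle (1 : ℚ)) : ∃ q' : AddCircle (1 : ℚ), q = m • q' := by
  induction q using QuotientAddGroup.induction_on with
  | H x =>
    refine ⟨((x / m : ℚ) : AddCircle (1 : ℚ)), ?_⟩
    rw [← AddCircle.coe_nsmul, nsmul_eq_mul, mul_div_cancel₀ _ (Nat.cast_ne_zero.2 hm)]

/-- **THE FIELD `invAt_bijective` OF `TateDualityHypotheses C̄ inv_F`** (`C̄ = (classData F).toSystem.toD`, door-c5's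
`classBarD F` definitionally; `inv_F = classBarInvD F`): for every open normal subgroup `U ≤ Γ_F`,
`inv_F ∘ cores_U : Ext²_{C_U}(ℤ, Res_U C̄) → ℚ/ℤ` is bijective (door-c4 `bijective_inv_comp_extCores` from `inv_U`
bijective, `inv_U ∘ Res = [Γ:U] • inv_F`, `inv_F` onto, `ℚ/ℤ` divisible).
[cite: MilneADT2006, I §1 (class formations, (1.1)) and Theorem 1.8][cite: Serre1979, XI §2 Proposition 1] -/
theorem invAt_classData_bijective (U : OpenNormalSubgroup (absoluteGaloisGroup F)) :
    Function.Bijective (DiscreteRep.invAt (classData F).toSystem.toD (classBarInvD F) U) := by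
  haveI := finiteIndex_of_openNormalSubgroup U
  exact bijective_inv_comp_extCores (U : Subgroup (absoluteGaloisGroup F)) U.toOpenSubgroup.isOpen
    (classData F).toSystem.toD (classBarInvD F)
    (classBarInvAt F (U : Subgroup (absoluteGaloisGroup F)) U.toOpenSubgroup.isOpen)
    (classBarInvAt_extRes F U) (classBarInvAt_bijective F U) (classBarInvD_surjective F)
    (exists_eq_nsmul _ Subgroup.FiniteIndex.index_ne_zero)


/-- **The same field in door-c5's spelling `classBarD F` of `C̄`** (`= (classData F).toSystem.toD` definitionally): for
every open normal subgroup `U ≤ Γ_F`, `invAt (classBarD F) inv_F U = inv_F ∘ cores_U` is bijective — verbatim the field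
`invAt_bijective` of `TateDualityHypotheses (classBarD F) (classBarInvD F)` (door-c4 `DiscreteRepTateDuality`).
[cite: MilneADT2006, I §1 (class formations, (1.1)) and Theorem 1.8] -/
theorem invAt_classBarD_bijective (U : OpenNormalSubgroup (absoluteGaloisGroup F)) :
    Function.Bijective (DiscreteRep.invAt (classBarD F) (classBarInvD F) U) :=
  invAt_classData_bijective F U

end Subgroup

end IdeleClassBar

end Literature.NumberTheory.GaloisRepresentations

end
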